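import Summits.QuantumFields.YangMills.Theorems.BalabanLadderUVSeamRecCeilingsFarUVThinning
import Summits.QuantumFields.YangMills.Theorems.BalabanLadderUVSeamRecCeilingsWindowCellLaws
import HarnessLib

/-!
# Crux `UVSeamRec` (stmt-QuantumFields-20043), v5(α) stub `stub_responseMomentsOdd6` (RM), lane B: the WINDOW CELL LAWS ARE INHABITED IN THE
# FAR ULTRAVIOLET — at every level `k`, on every odd torus, with activity `(min 1 (n_k·δ₀(β, θ_k(ε))))^{1/C} → 0` (`β → ∞`)

Helper file (`--supports stmt-QuantumFields-20043`) of the width-lever seat `ym-20043-ceilings-p2` (lane B, gen 4); sequel of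
`…CeilingsFarUVTransfer` (a level-`k` large field is carried by a fine plaquette excitation `θ_k(ε) = min(ε/2, (109824 b² N)⁻²)/(2N b^{4k})` within
`ρ_k = (8b+2)Σ_{l<k} b^l + 1 < 9b^k` of the block) and of g3's `…CeilingsLevelZeroLaw` (p553454, the PROVED period-free level-`0` Peierls gas
`δ₀(β, ε₀) = exp(−βNε₀/6 + (K₀ + D₁ log β)/6)` on every odd torus) and `…CeilingsWindowCellLaws` (p554392, whose hypothesis hWCL this file inhabits).

THE THEOREM (`torusE_prod_indicator_largeField_le_farUV`).  For the fundamental Wilson state of `SU(N)`, block size `b ≥ 11`, threshold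
`ε > 0`, every odd torus `2L+1` (`L ≥ 1`), `β ≥ 1`, every level `k` and every finite family `A` of level-`k` block-plaquettes whose blocks fit in one
period window (`o ≤ b^k y`, `b^k y + b^k ≤ o + 2L+1` — the binder of hWCL VERBATIM):
`⟨∏_{γ∈A} 1_{largeFieldEvent 𝔟 ε γ}∘lift⟩_{2L+1,β} ≤ ∏_{γ∈A} (min 1 (n_k·δ₀(β, θ_k(ε))))^{1/C}`, `n_k = 16(2ρ_k+1)⁴`, `C = 16²·19⁴`.
So at each FIXED level the window cell law holds with an activity tending to `0` as `β → ∞`, uniformly in the torus and in the family; it is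
nontrivial exactly in the far-UV window `b^{4k} ≲ β/log β`.

PROOF (the engines are in `…CeilingsFarUVThinning`).  (i) an abstract union bound: if every `E_γ` is covered by `≤ n` witness events and every transversal of witnesses obeys a product law with
activity `δ`, then `⟨∏_{γ∈A′} 1_{E_γ}⟩ ≤ (nδ)^{#A′}` (`torusE_prod_indicator_le_of_witnesses`).  (ii) THINNING (`exists_conflictFree_subfamily`): a window family has a CONFLICT-FREE
subfamily `A′` — distinct members have witness boxes with disjoint torus projections in some coordinate — with `#A ≤ C·#A′`: colour by
(orientation, `y mod 19`, half-window bits) and keep the largest class when `2ρ_k ≤ L` (same colour ⇒ anchors `≥ 19b^k ≥ 2ρ_k+1` apart in some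
coordinate and `≤ L` apart, so no translate by the period closes the gap), or keep one member when `L < 2ρ_k` (then `#A ≤ 16·35⁴ ≤ C`).  (iii) for a
conflict-free family every transversal of `…FarUVTransfer`'s witnesses is a PERIOD-FREE level-`0` family, so p553454 applies with `ε₀ := θ_k(ε)`.
(iv) assembly, dropping the other members (`torusE_prod_indicator_anti`) and `x^{#A′} ≤ x^{#A/C}` for `x ≤ 1`.

HONEST FRAMING: an UNCONDITIONAL inhabitation of lane B's single-scale supplier target at every fixed level — a far-UV rung with Bałaban-size
constants (`C₀(4) = 36608`), nontrivial iff `b^{4k} ≲ β/log β`; the characteristic scales `b^k ≍ R ≍ ℓ₁/a(β)` of (RM) need the effective-action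
large-field bounds of [Balaban1989LargeFieldII] (R-operation) — OPEN; in the bounded-cutoff regime the (EM_I) half is free anyway (tempered-d1 p554899).
Nothing of E0′; not a gap, not Clay.
References: T. Bałaban, Commun. Math. Phys. 98 (1985) 17–51 (Prop. 2); 122 (1989) 355–392; J. Fröhlich, R. Israel, E. H. Lieb, B. Simon, Commun.
Math. Phys. 62 (1978) §5 (via p530009/p553454); folklore.
-/

set_option autoImplicit false

noncomputable section

open MeasureTheory Filter Topology Finset
open Literature.Probability.LatticeModels
open Literature.MathematicalPhysics.QuantumFieldTheory (GaugeConfig wilsonMeasure isProbabilityMeasure_wilsonMeasure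
  measurable_torusLift LatticeRep)
open Literature.MathematicalPhysics.QuantumLattice

namespace Summit.QuantumFields.YangMills.Cruxes.UVSeamRec.PolymerRarity

open Summit.QuantumFields.YangMills.Cruxes.OSLegsFromFemtoAndGap.DlrCollarTransfer
open Summit.QuantumFields.YangMills.Cruxes.UVSeamRec.PolymerData
open Summit.QuantumFields.YangMills.Cruxes.UVSeamRec.TemperedResponse (torusE_prod_indicator_anti torusE_prod_indicator_levelZero_le)
open Summit.QuantumFields.YangMills.Theorems.OddTorusChessboard (Orient)

/-! ## The far-UV window cell law -/

section FarUV

variable {N : ℕ} [NeZero N]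

/-- **THE WINDOW CELL LAWS ARE INHABITED IN THE FAR ULTRAVIOLET.**  For the fundamental Wilson state of `SU(N)` (`N ≥ 1`) there are constants
`K₀, D₁` (those of the proved period-free level-`0` Peierls gas, p553454) such that for every block size `b ≥ 11`, threshold `ε > 0`, odd torus
`2L+1` (`L ≥ 1`), `β ≥ 1`, level `k`, window origin `o` and finite family `A` of level-`k` block-plaquettes whose blocks fit in the period window
`[o, o + 2L+1)⁴` — the binder of the hypothesis hWCL of `TemperedResponse.torusE_exp_two_mul_sum_influence_le_of_windowCellLaws` VERBATIM —
`⟨∏_{γ∈A} 1_{largeFieldEvent 𝔟 ε γ}∘lift⟩_{2L+1,β} ≤ ∏_{γ∈A} (min 1 (n_k·δ₀))^{1/C}` with `n_k = 16(2ρ_k+1)⁴`, `ρ_k = (8b+2)Σ_{l<k} b^l + 1`,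
`δ₀ = exp(−βNθ_k(ε)/#Orient + (K₀ + D₁ log β)/#Orient)`, `θ_k(ε) = min(ε/2, (109824 b² N)⁻²)/(2N(b^k)⁴)`, `C = 33362176 = 16²·19⁴`: at every FIXED
level an activity in `[0,1]` tending to `0` as `β → ∞`, uniformly in the torus and the family — the far-UV rung of lane B's supplier target
(nontrivial iff `b^{4k} ≲ β/log β`).  Proof: `…FarUVTransfer.exists_levelZero_witness_of_mem_largeFieldEvent` (Bałaban's local Prop. 2, tree N21)
covers each `E_γ` by `≤ n_k` level-`0` events; thin `A` to a conflict-free `A′` (`exists_conflictFree_subfamily`); every transversal of witnesses of `A′` is a period-free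
level-`0` family, so p553454 bounds it by `δ₀^{#A′}` (`torusE_prod_indicator_le_of_witnesses`); finally `x^{#A′} ≤ x^{#A/C}` for `x ≤ 1`. [cite: Balaban1985Averaging, Prop. 2 (52)–(54) p.26] -/
theorem torusE_prod_indicator_largeField_le_farUV :
    ∃ K₀ : ℝ, ∃ D₁ : ℕ, ∀ (𝔟 : BlockSize), 11 ≤ 𝔟.b → ∀ (ε : ℝ), 0 < ε → ∀ (L : ℕ), 1 ≤ L → ∀ (β : ℝ), 1 ≤ β →
      ∀ (k : ℕ) (o : Fin 4 → ℤ) (A : Finset Polymer), (∀ γ ∈ A, γ.k = k) →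
        (∀ γ ∈ A, ∀ c, o c ≤ anchor 𝔟 γ c ∧ anchor 𝔟 γ c + (𝔟.b : ℤ) ^ k ≤ o c + (2 * L + 1)) →
        torusE (Matrix.specialUnitaryGroup (Fin N) ℂ) (fundamentalLatticeRep N) β L (fun U => ∏ γ ∈ A,
          (largeFieldEvent (N := N) 𝔟 ε γ).indicator (fun _ => (1 : ℝ)) U) ≤
          ∏ _γ ∈ A, (min 1 (((16 * (2 * ((8 * 𝔟.b + 2) * ∑ l ∈ Finset.range k, 𝔟.b ^ l + 1) + 1) ^ 4 : ℕ) : ℝ) *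
            Real.exp (-(β * ((N : ℝ) * (min (ε / 2) ((1 / (109824 * (𝔟.b : ℝ) ^ 2 * N)) ^ 2) /
              (2 * N * ((𝔟.b : ℝ) ^ k) ^ 4)))) / Fintype.card (Orient 4) +
              (K₀ + D₁ * Real.log β) / Fintype.card (Orient 4)))) ^ ((1 : ℝ) / 33362176) := by
  classical
  obtain ⟨K₀, D₁, hPL0⟩ := torusE_prod_indicator_levelZero_le (N := N)
  refine ⟨K₀, D₁, ?_⟩
  intro 𝔟 hb ε hε L hL β hβ k o A hA hwin
  haveI := isProbabilityMeasure_wilsonMeasure (d := 4) (L := 2 * L + 1) (fundamentalLatticeRep N).ρ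
    (fundamentalLatticeRep N).continuous β
  -- notation
  set R0 : ℕ := (8 * 𝔟.b + 2) * ∑ l ∈ Finset.range k, 𝔟.b ^ l with hR0def
  set t : ℕ := (𝔟.b ^ k - 1) / 2 with htdef
  set θ : ℝ := min (ε / 2) ((1 / (109824 * (𝔟.b : ℝ) ^ 2 * N)) ^ 2) / (2 * N * ((𝔟.b : ℝ) ^ k) ^ 4) with hθdef
  set δ₀ : ℝ := Real.exp (-(β * ((N : ℝ) * θ)) / Fintype.card (Orient 4) + (K₀ + D₁ * Real.log β) / Fintype.card (Orient 4))
    with hδ₀def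
  set n : ℕ := 16 * (2 * (R0 + 1) + 1) ^ 4 with hndef
  have hδ₀pos : 0 < δ₀ := Real.exp_pos _
  -- the events and the witness sets
  set E : Polymer → Set (LGConfig 4 (Matrix.specialUnitaryGroup (Fin N) ℂ)) := fun γ => largeFieldEvent (N := N) 𝔟 ε γ with hEdef
  set E0 : Polymer → Set (LGConfig 4 (Matrix.specialUnitaryGroup (Fin N) ℂ)) := fun w => largeFieldEvent (N := N) 𝔟 θ w with hE0def
  set cen : Polymer → Fin 4 → ℤ := fun γ i => (𝔟.b : ℤ) ^ k * γ.y i + (t : ℤ) with hcendef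
  set W : Polymer → Finset Polymer := fun γ =>
    ((Fintype.piFinset fun i => Finset.Icc (cen γ i - ((R0 : ℤ) + 1)) (cen γ i + ((R0 : ℤ) + 1))) ×ˢ
      (Finset.univ : Finset (Orient 4))).image fun p => (⟨0, p.1, p.2.1.1, p.2.1.2, p.2.2⟩ : Polymer) with hWdef
  have hWmem : ∀ γ w, w ∈ W γ → w.k = 0 ∧ ∀ i, |w.y i - cen γ i| ≤ (R0 : ℤ) + 1 := by
    intro γ w hw
    simp only [hWdef, Finset.mem_image, Finset.mem_product, Fintype.mem_piFinset, Finset.mem_Icc, Finset.mem_univ,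
      and_true] at hw
    obtain ⟨p, hp, rfl⟩ := hw
    exact ⟨rfl, fun i => abs_le.2 ⟨by linarith [(hp i).1], by linarith [(hp i).2]⟩⟩
  have hWn : ∀ γ ∈ A, (W γ).card ≤ n := by
    intro γ _
    refine Finset.card_image_le.trans ?_
    rw [Finset.card_product, Fintype.card_piFinset, Finset.card_univ]
    have h1 : Fintype.card (Orient 4) ≤ 16 := (Fintype.card_subtype_le _).trans (by simp)
    have h3 : ∀ i : Fin 4, (Finset.Icc (cen γ i - ((R0 : ℤ) + 1)) (cen γ i + ((R0 : ℤ) + 1))).card = 2 * (R0 + 1) + 1 := by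
      intro i
      rw [Int.card_Icc, show cen γ i + ((R0 : ℤ) + 1) + 1 - (cen γ i - ((R0 : ℤ) + 1)) = ((2 * (R0 + 1) + 1 : ℕ) : ℤ) by
        push_cast; ring, Int.toNat_natCast]
    simp only [h3, Finset.prod_const, Finset.card_univ, Fintype.card_fin, hndef]
    nlinarith [Nat.zero_le ((2 * (R0 + 1) + 1) ^ 4)]
  -- each `E_γ` is covered by its witnesses (`…FarUVTransfer`)
  have hcover : ∀ γ ∈ A, ∀ η, η ∈ E γ → ∃ w ∈ W γ, η ∈ E0 w := by
    intro γ hγ η hη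
    have hγk := hA γ hγ
    obtain ⟨kk, y, μ, ν, h⟩ := γ
    simp only at hγk
    subst hγk
    obtain ⟨z, μ', ν', h', hbox, hmem⟩ :=
      exists_levelZero_witness_of_mem_largeFieldEvent (N := N) 𝔟 hb hε _ y μ ν h η hη
    refine ⟨⟨0, z, μ', ν', h'⟩, ?_, hmem⟩
    simp only [hWdef, Finset.mem_image, Finset.mem_product, Fintype.mem_piFinset, Finset.mem_Icc, Finset.mem_univ, and_true]
    refine ⟨(z, ⟨(μ', ν'), h'⟩), fun i => ?_, rfl⟩
    have := abs_le.1 (hbox i)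
    simp only [hcendef]
    constructor <;> linarith
  -- thin the family
  obtain ⟨A', hA'A, hA'ne, hA'card, hCF⟩ := exists_conflictFree_subfamily 𝔟 hb k L o A hA hwin
  have hA'k : ∀ γ ∈ A', γ.k = k := fun γ hγ => hA γ (hA'A hγ)
  -- every transversal of witnesses of `A'` is a period-free level-0 family: the law `δ₀^{#A'}`
  have hlaw : ∀ f ∈ A'.pi W, torusE (Matrix.specialUnitaryGroup (Fin N) ℂ) (fundamentalLatticeRep N) β L
      (fun U => ∏ γ ∈ A'.attach, (E0 (f γ.1 γ.2)).indicator (fun _ => (1 : ℝ)) U) ≤ δ₀ ^ A'.card := by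
    intro f hf
    rw [Finset.mem_pi] at hf
    set g : {x // x ∈ A'} → Polymer := fun γ => f γ.1 γ.2 with hgdef
    -- witnesses of distinct members differ on the torus
    have hsep : ∀ γ₁ γ₂ : {x // x ∈ A'}, γ₁ ≠ γ₂ →
        (fun w : Polymer => (w.k, Torus.proj (2 * L + 1) (anchor 𝔟 w), w.μ, w.ν)) (g γ₁) ≠
          (fun w : Polymer => (w.k, Torus.proj (2 * L + 1) (anchor 𝔟 w), w.μ, w.ν)) (g γ₂) := by
      intro γ₁ γ₂ hne heq
      have hne' : γ₁.1 ≠ γ₂.1 := fun h => hne (Subtype.ext h)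
      obtain ⟨i, hi⟩ := hCF γ₁.1 γ₁.2 γ₂.1 γ₂.2 hne'
      obtain ⟨hk1, hb1⟩ := hWmem γ₁.1 (g γ₁) (hf γ₁.1 γ₁.2)
      obtain ⟨hk2, hb2⟩ := hWmem γ₂.1 (g γ₂) (hf γ₂.1 γ₂.2)
      simp only [Prod.mk.injEq] at heq
      have hproj := congrFun heq.2.1 i
      have ha1 : anchor 𝔟 (g γ₁) = (g γ₁).y := by funext j; rw [anchor, hk1, pow_zero, one_mul]
      have ha2 : anchor 𝔟 (g γ₂) = (g γ₂).y := by funext j; rw [anchor, hk2, pow_zero, one_mul]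
      rw [ha1, ha2] at hproj
      have hproj' : (((g γ₁).y i : ℤ) : ZMod (2 * L + 1)) = (((g γ₂).y i : ℤ) : ZMod (2 * L + 1)) := hproj
      have e1 : (g γ₁).y i = (𝔟.b : ℤ) ^ k * γ₁.1.y i + ((g γ₁).y i - cen γ₁.1 i) + (t : ℤ) := by simp only [hcendef]; ring
      have e2 : (g γ₂).y i = (𝔟.b : ℤ) ^ k * γ₂.1.y i + ((g γ₂).y i - cen γ₂.1 i) + (t : ℤ) := by simp only [hcendef]; ring
      refine hi ((g γ₁).y i - cen γ₁.1 i) ((g γ₂).y i - cen γ₂.1 i) (hb1 i) (hb2 i) ?_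
      have h3 : (((g γ₁).y i - (t : ℤ) : ℤ) : ZMod (2 * L + 1)) = (((g γ₂).y i - (t : ℤ) : ℤ) : ZMod (2 * L + 1)) := by
        push_cast; rw [hproj']
      rw [e1, e2] at h3
      simpa using h3
    have hinj : Set.InjOn g ↑A'.attach := by
      intro γ₁ _ γ₂ _ h
      by_contra hne
      exact hsep γ₁ γ₂ hne (by simp only [h])
    set B := A'.attach.image g with hBdef
    have hB0 : ∀ w ∈ B, w.k = 0 := by
      intro w hw
      obtain ⟨γ, -, rfl⟩ := Finset.mem_image.1 hw
      exact (hWmem γ.1 (g γ) (hf γ.1 γ.2)).1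
    have hBinj : Set.InjOn (fun w : Polymer => (w.k, Torus.proj (2 * L + 1) (anchor 𝔟 w), w.μ, w.ν)) ↑B := by
      intro w₁ hw₁ w₂ hw₂ h
      obtain ⟨γ₁, -, rfl⟩ := Finset.mem_image.1 (Finset.mem_coe.1 hw₁)
      obtain ⟨γ₂, -, rfl⟩ := Finset.mem_image.1 (Finset.mem_coe.1 hw₂)
      by_cases hγ : γ₁ = γ₂
      · rw [hγ]
      · exact absurd h (hsep γ₁ γ₂ hγ)
    have hprod : (fun U : LGConfig 4 (Matrix.specialUnitaryGroup (Fin N) ℂ) =>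
        ∏ γ ∈ A'.attach, (E0 (f γ.1 γ.2)).indicator (fun _ => (1 : ℝ)) U) =
        fun U => ∏ w ∈ B, (largeFieldEvent (N := N) 𝔟 θ w).indicator (fun _ => (1 : ℝ)) U := by
      funext U
      rw [hBdef, Finset.prod_image hinj]
    rw [hprod]
    refine (hPL0 𝔟 θ L hL β hβ B hB0 hBinj).trans (le_of_eq ?_)
    rw [Finset.prod_const, hBdef, Finset.card_image_of_injOn hinj, Finset.card_attach]
  -- the union bound for the conflict-free subfamily
  have hA' : torusE (Matrix.specialUnitaryGroup (Fin N) ℂ) (fundamentalLatticeRep N) β L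
      (fun U => ∏ γ ∈ A', (E γ).indicator (fun _ => (1 : ℝ)) U) ≤ ((n : ℝ) * δ₀) ^ A'.card :=
    torusE_prod_indicator_le_of_witnesses (fundamentalLatticeRep N) β L A' E
      W E0 (fun w => measurableSet_largeFieldEvent (N := N) 𝔟 θ w)
      n (fun γ hγ => hWn γ (hA'A hγ)) (fun γ hγ => hcover γ (hA'A hγ)) δ₀ hδ₀pos.le hlaw
  -- assembly
  have hmono := torusE_prod_indicator_anti (fundamentalLatticeRep N) β L E
    (fun γ => measurableSet_largeFieldEvent (N := N) 𝔟 ε γ) hA'A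
  have hle1 : torusE (Matrix.specialUnitaryGroup (Fin N) ℂ) (fundamentalLatticeRep N) β L
      (fun U => ∏ γ ∈ A, (E γ).indicator (fun _ => (1 : ℝ)) U) ≤ 1 := by
    have h := torusE_prod_indicator_anti (fundamentalLatticeRep N) β L E
      (fun γ => measurableSet_largeFieldEvent (N := N) 𝔟 ε γ) (Finset.empty_subset A)
    refine h.trans (le_of_eq ?_)
    simp only [Finset.prod_empty]
    unfold torusE
    rw [integral_const, smul_eq_mul, mul_one, probReal_univ]
  set x : ℝ := min 1 ((n : ℝ) * δ₀) with hxdef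
  have hx0 : 0 < x := lt_min one_pos (mul_pos (by rw [hndef]; positivity) hδ₀pos)
  have hx1 : x ≤ 1 := min_le_left _ _
  have hTx : torusE (Matrix.specialUnitaryGroup (Fin N) ℂ) (fundamentalLatticeRep N) β L
      (fun U => ∏ γ ∈ A, (E γ).indicator (fun _ => (1 : ℝ)) U) ≤ x ^ A'.card := by
    rcases le_total 1 ((n : ℝ) * δ₀) with h1 | h1
    · rw [hxdef, min_eq_left h1, one_pow]; exact hle1
    · rw [hxdef, min_eq_right h1]; exact hmono.trans hA'
  -- `x^{#A'} ≤ x^{#A/C}`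
  have hexp : (A.card : ℝ) / 33362176 ≤ (A'.card : ℝ) := by
    rw [div_le_iff₀ (by norm_num)]
    have : (A.card : ℝ) ≤ (33362176 : ℝ) * A'.card := by exact_mod_cast hA'card
    linarith
  rw [Finset.prod_const]
  show _ ≤ (x ^ ((1 : ℝ) / 33362176)) ^ A.card
  rw [← Real.rpow_natCast (x ^ ((1 : ℝ) / 33362176)) A.card, ← Real.rpow_mul hx0.le,
    show (1 : ℝ) / 33362176 * (A.card : ℝ) = (A.card : ℝ) / 33362176 by ring]
  refine hTx.trans ?_
  rw [← Real.rpow_natCast x A'.card]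
  exact Real.rpow_le_rpow_of_exponent_ge hx0 hx1 hexp

/-- **THE WINDOW CELL LAWS ARE INHABITED WITH VANISHING ACTIVITIES** (the legible form of `torusE_prod_indicator_largeField_le_farUV`): there is
an activity `δ(𝔟, ε, k, β) ∈ [0, 1]` with `δ(𝔟, ε, k, β) → 0` as `β → ∞` for every block size `b ≥ 11`, threshold `ε > 0` and FIXED level `k`,
such that the window cell law `⟨∏_{γ∈A} 1_{largeFieldEvent 𝔟 ε γ}∘lift⟩_{2L+1,β} ≤ ∏_{γ∈A} δ(𝔟, ε, k, β)` holds for every odd torus (`L ≥ 1`), every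
`β ≥ 1` and every level-`k` family whose blocks fit in one period window — the hypothesis hWCL of p554392 is SATISFIABLE AS TYPED, level by
level, on ALL odd tori (no reflection positivity beyond the plaquette scale, no divisibility).  Far-UV rung: `δ < 1` only for `b^{4k} ≲ β/log β`.
[cite: Balaban1985Averaging, Prop. 2 (52)–(54) p.26] -/
theorem windowCellLaws_inhabited_farUV :
    ∃ δ : BlockSize → ℝ → ℕ → ℝ → ℝ,
      (∀ 𝔟 ε k β, 0 ≤ δ 𝔟 ε k β ∧ δ 𝔟 ε k β ≤ 1) ∧
      (∀ (𝔟 : BlockSize) (ε : ℝ) (k : ℕ), 11 ≤ 𝔟.b → 0 < ε → Tendsto (fun β => δ 𝔟 ε k β) atTop (𝓝 0)) ∧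
      ∀ (𝔟 : BlockSize), 11 ≤ 𝔟.b → ∀ (ε : ℝ), 0 < ε → ∀ (L : ℕ), 1 ≤ L → ∀ (β : ℝ), 1 ≤ β →
        ∀ (k : ℕ) (o : Fin 4 → ℤ) (A : Finset Polymer), (∀ γ ∈ A, γ.k = k) →
          (∀ γ ∈ A, ∀ c, o c ≤ anchor 𝔟 γ c ∧ anchor 𝔟 γ c + (𝔟.b : ℤ) ^ k ≤ o c + (2 * L + 1)) →
          torusE (Matrix.specialUnitaryGroup (Fin N) ℂ) (fundamentalLatticeRep N) β L (fun U => ∏ γ ∈ A,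
            (largeFieldEvent (N := N) 𝔟 ε γ).indicator (fun _ => (1 : ℝ)) U) ≤ ∏ _γ ∈ A, δ 𝔟 ε k β := by
  obtain ⟨K₀, D₁, hlaw⟩ := torusE_prod_indicator_largeField_le_farUV (N := N)
  -- the far-UV activity of the main theorem
  refine ⟨fun 𝔟 ε k β => (min 1 (((16 * (2 * ((8 * 𝔟.b + 2) * ∑ l ∈ Finset.range k, 𝔟.b ^ l + 1) + 1) ^ 4 : ℕ) : ℝ) *
      Real.exp (-(β * ((N : ℝ) * (min (ε / 2) ((1 / (109824 * (𝔟.b : ℝ) ^ 2 * N)) ^ 2) /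
        (2 * N * ((𝔟.b : ℝ) ^ k) ^ 4)))) / Fintype.card (Orient 4) +
        (K₀ + D₁ * Real.log β) / Fintype.card (Orient 4)))) ^ ((1 : ℝ) / 33362176),
    fun 𝔟 ε k β => ?_, fun 𝔟 ε k hb hε => ?_, fun 𝔟 hb ε hε L hL β hβ k o A hA hwin => hlaw 𝔟 hb ε hε L hL β hβ k o A hA hwin⟩
  · -- `0 ≤ δ ≤ 1`
    have h0 : 0 ≤ min 1 (((16 * (2 * ((8 * 𝔟.b + 2) * ∑ l ∈ Finset.range k, 𝔟.b ^ l + 1) + 1) ^ 4 : ℕ) : ℝ) *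
        Real.exp (-(β * ((N : ℝ) * (min (ε / 2) ((1 / (109824 * (𝔟.b : ℝ) ^ 2 * N)) ^ 2) /
          (2 * N * ((𝔟.b : ℝ) ^ k) ^ 4)))) / Fintype.card (Orient 4) + (K₀ + D₁ * Real.log β) / Fintype.card (Orient 4))) :=
      le_min zero_le_one (mul_nonneg (Nat.cast_nonneg _) (Real.exp_pos _).le)
    exact ⟨Real.rpow_nonneg h0 _, Real.rpow_le_one h0 (min_le_left _ _) (by norm_num)⟩
  · -- `δ → 0` as `β → ∞` at fixed `(b, ε, k)`: the exponent is `−cβ + O(log β)`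
    set n : ℝ := ((16 * (2 * ((8 * 𝔟.b + 2) * ∑ l ∈ Finset.range k, 𝔟.b ^ l + 1) + 1) ^ 4 : ℕ) : ℝ) with hndef
    set θ : ℝ := min (ε / 2) ((1 / (109824 * (𝔟.b : ℝ) ^ 2 * N)) ^ 2) / (2 * N * ((𝔟.b : ℝ) ^ k) ^ 4) with hθdef
    set m : ℝ := (Fintype.card (Orient 4) : ℝ) with hmdef
    have hb0 : (0 : ℝ) < 𝔟.b := by exact_mod_cast 𝔟.pos
    have hN0 : (0 : ℝ) < N := by exact_mod_cast Nat.pos_of_ne_zero (NeZero.ne N)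
    have hθ0 : 0 < θ := by rw [hθdef]; positivity
    have hm0 : 0 < m := by
      rw [hmdef]
      exact_mod_cast Fintype.card_pos_iff.2 ⟨(⟨((0 : Fin 4), (1 : Fin 4)), by decide⟩ : Orient 4)⟩
    set c : ℝ := (N : ℝ) * θ / m with hcdef
    have hc0 : 0 < c := by rw [hcdef]; positivity
    -- `log β ≤ (c/(2(D₁+1))) β` eventually
    have hlog : ∀ᶠ β : ℝ in atTop, ‖Real.log β‖ ≤ (c * m / (2 * ((D₁ : ℝ) + 1))) * ‖β‖ :=
      Real.isLittleO_log_id_atTop.bound (by positivity)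
    have hexp_le : ∀ᶠ β : ℝ in atTop, -(β * ((N : ℝ) * θ)) / m + (K₀ + D₁ * Real.log β) / m ≤ -(c / 2) * β + K₀ / m := by
      filter_upwards [hlog, eventually_ge_atTop (1 : ℝ)] with β hβ hβ1
      rw [Real.norm_eq_abs, Real.norm_eq_abs, abs_of_nonneg (Real.log_nonneg hβ1), abs_of_nonneg (by linarith : (0 : ℝ) ≤ β)] at hβ
      have hD : (0 : ℝ) ≤ D₁ := Nat.cast_nonneg _
      have h1 : (D₁ : ℝ) * Real.log β ≤ (D₁ : ℝ) * ((c * m / (2 * ((D₁ : ℝ) + 1))) * β) := mul_le_mul_of_nonneg_left hβ hD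
      have h2 : (D₁ : ℝ) * ((c * m / (2 * ((D₁ : ℝ) + 1))) * β) ≤ c * m / 2 * β := by
        rw [show (D₁ : ℝ) * ((c * m / (2 * ((D₁ : ℝ) + 1))) * β) = ((D₁ : ℝ) / ((D₁ : ℝ) + 1)) * (c * m / 2 * β) by
          field_simp]
        have h3 : (D₁ : ℝ) / ((D₁ : ℝ) + 1) ≤ 1 := by rw [div_le_one (by positivity)]; linarith
        have h4 : 0 ≤ c * m / 2 * β := by positivity
        nlinarith
      have e1 : -(β * ((N : ℝ) * θ)) / m + (K₀ + D₁ * Real.log β) / m = -(c * β) + K₀ / m + ((D₁ : ℝ) * Real.log β) / m := by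
        rw [hcdef]; field_simp; ring
      have h5 : ((D₁ : ℝ) * Real.log β) / m ≤ c / 2 * β := by
        rw [div_le_iff₀ hm0]
        have h6 := h1.trans h2
        nlinarith
      rw [e1]
      linarith
    have hlin : Tendsto (fun β : ℝ => -(c / 2) * β + K₀ / m) atTop atBot := by
      have h1 : Tendsto (fun β : ℝ => (c / 2) * β) atTop atTop := tendsto_id.const_mul_atTop (by positivity)
      have h2 : Tendsto (fun β : ℝ => -((c / 2) * β)) atTop atBot := tendsto_neg_atTop_atBot.comp h1
      exact tendsto_atBot_add_const_right _ _ (h2.congr fun β => by ring)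
    have hexp : Tendsto (fun β : ℝ => Real.exp (-(β * ((N : ℝ) * θ)) / m + (K₀ + D₁ * Real.log β) / m)) atTop (𝓝 0) :=
      Real.tendsto_exp_atBot.comp (tendsto_atBot_mono' _ hexp_le hlin)
    have hnexp : Tendsto (fun β : ℝ => n * Real.exp (-(β * ((N : ℝ) * θ)) / m + (K₀ + D₁ * Real.log β) / m)) atTop (𝓝 0) := by
      simpa using hexp.const_mul n
    have hmin : Tendsto (fun β : ℝ => min 1 (n * Real.exp (-(β * ((N : ℝ) * θ)) / m + (K₀ + D₁ * Real.log β) / m))) atTop (𝓝 0) := by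
      refine squeeze_zero (fun β => le_min zero_le_one (mul_nonneg (by rw [hndef]; positivity) (Real.exp_pos _).le))
        (fun β => min_le_right _ _) hnexp
    have hpow := hmin.rpow_const (p := (1 : ℝ) / 33362176) (Or.inr (by norm_num))
    rw [Real.zero_rpow (by norm_num)] at hpow
    exact hpow

end FarUV

end Summit.QuantumFields.YangMills.Cruxes.UVSeamRec.PolymerRarity

end
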